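import Literature.Analysis.SegalBargmann.SchrodingerCompactRigidity
import HarnessLib

/-!
# The compact dual pair `(U(p)×U(q)) × (U(r)×U(s)) → U((p+q)(r+s))` on the Fock / Schrödinger model: the block
# datum with conjugated holomorphic blocks, its torus, and the weights of a covariant realisation

Source followed for the statements: G. B. Folland, *Harmonic Analysis in Phase Space* (1989), Prop. (4.39)
("If `P ∈ U(n)` then `ν[(P 0; 0 P̄)]F(z) = (det^{-1/2}P) F(P^{-1}z)`", the `U(n)`-part of the metaplectic
representation, here through the tree's `fockRep`/`schrodingerU`) and Ch. 4 §5 ("`U(1)` acts on `𝓟_k` … by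
`e^{iθ} → e^{-ikθ}`"); and, for the shape of the compact dual pair inside `U(n)`, R. Howe, *Transcending classical
invariant theory*, J. AMS 2 (1989) §§3–4 / A. Ichino, *Theta lifting for tempered representations of real unitary
groups*, Adv. Math. 398 (2022) (arXiv:2008.06174) §2.2, §7.5 (the Fock model "`𝒫` = polynomials in `mn`
variables" for `(U(p,q), U(r,s))`).  Nothing is cited as a fact: this file only DEFINES the embedding and PROVES its
bookkeeping (Mathlib + tree).

## The datum

For finite index types `P, Q, R, S` (think: orthonormal bases of `V⁺, V⁻, W⁺, W⁻` for a hermitian `V` of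
signature `(|P|,|Q|)` and a (skew-)hermitian `W` of signature `(|R|,|S|)`), the phase space `𝕎 = V ⊗ W` has the
complex coordinates indexed by

  `DPIdx P Q R S := ((P × R) ⊕ (Q × S)) ⊕ ((P × S) ⊕ (Q × R))`

— first the two pair-blocks on which the product form is DEFINITE OF THE SAME SIGN ("holomorphic" pair-blocks),
then the two mixed ones.  The maximal compact `K × K′ = (U(P)×U(Q)) × (U(R)×U(S))` of the dual pair acts on `𝕎`
through Kronecker products block by block; with the tree's Folland conventions (`ψ = e^{2πix}`,
`fockRep U F = F ∘ U⁻¹`, weight `−1` per degree) the realisation whose polynomial weights are POSITIVE in the degree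
on the same-sign blocks (Ichino's normalisation `ψ_∞ = e^{−2π√−1 x}`, [Ich22] §4.1, and the explicit models of
`Literature/RepresentationTheory/Ichino2022/*`) is the one in which those two blocks enter CONJUGATED:

  `dualPairι ((a,b),(c,d)) = diag( conj(a ⊗ c), conj(b ⊗ d), a ⊗ d, b ⊗ c ) ∈ U(DPIdx P Q R S)`.

## Results

* `conjU`, `kronU`, `blockU` — entrywise conjugation, Kronecker product and block sum as continuous homomorphisms
  of unitary groups; `dualPairι` — the block datum above, a continuous homomorphism (`continuous_dualPairι`),
  with its matrix (`coe_dualPairι`).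
* `dualPairι_diagHom` — on the torus `(a,b,c,d) = (diag α, diag β, diag γ, diag δ)` the datum is the diagonal
  torus element `diagHom (dpTorus α β γ δ)` of `U(DPIdx)`, and `torusChar_dpTorus` computes the tree's polynomial
  weight `torusChar m (dpTorus …)` of the monomial `z^m`:
  `∏_{(p,r)} (α_p γ_r)^{m_{pr}} · ∏_{(q,s)} (β_q δ_s)^{m_{qs}} · ∏_{(p,s)} (α_p δ_s)^{−m_{ps}} · ∏_{(q,r)} (β_q γ_r)^{−m_{qr}}`
  (inverse = conjugate on `S¹`): POSITIVE degree weights on the same-sign blocks, NEGATIVE on the mixed ones.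
* **`IsRhoCovariant.apply_hermiteL2_dualPair_torus`** — for ANY family `ω` of unitaries of `L²(ℝ^{DPIdx})` that is
  Heisenberg-covariant through `dualPairι` (e.g. the archimedean Weil representation of the dual pair restricted to
  `K×K′`, in any realisation), the Hermite function `h_m` is a weight vector of the torus with weight
  `vacCoeff ω k · torusChar m (dpTorus α β γ δ)` — vacuum character times the displayed polynomial weight.
* `U(W)`-scalar specialisation (`torusChar_dpTorus_scalarW`): the centre `t·1` of `U(R) × U(S)`… for a LINE
  (`S = ∅` or `R = ∅`) the `U(W) = U(1)`-weight of `z^m` is `t^{(deg_{P×R} m − deg_{Q×R} m)}` (resp. its inverse):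
  "`z_a ↦ +1`, `w ↦ −1`" of the explicit `(U(1), U(2,1))` model.

## References

* [Folland1989] G. B. Folland, *Harmonic Analysis in Phase Space*, Princeton UP 1989, Prop. (4.39) p. 161, Ch. 4 §5
  p. 182.
* [Howe1989] R. Howe, Transcending classical invariant theory, J. Amer. Math. Soc. 2 (1989), §§3–4.
* [Ichino2022] A. Ichino, Theta lifting for tempered representations of real unitary groups, Adv. Math. 398 (2022),
  arXiv:2008.06174, §2.2, §4.1, §7.5.
-/

noncomputable section

open MeasureTheory Complex Matrix
open scoped InnerProductSpace ComplexConjugate Real Kronecker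

namespace Literature.Analysis.SegalBargmann

set_option autoImplicit false

/-! ## 1. Conjugation, Kronecker product, block sum as homomorphisms of unitary groups -/

section Homs

variable {m n : Type*} [Fintype m] [DecidableEq m] [Fintype n] [DecidableEq n]

/-- **Entrywise complex conjugation `U ↦ Ū`** as a homomorphism `U(m) →* U(m)`. [folklore] -/
def conjU : Matrix.unitaryGroup m ℂ →* Matrix.unitaryGroup m ℂ where
  toFun U := Matrix.UnitaryGroup.map_star U
  map_one' := Subtype.ext (by
    change ((1 : Matrix.unitaryGroup m ℂ) : Matrix m m ℂ).map star = 1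
    rw [OneMemClass.coe_one, Matrix.map_one star (star_zero ℂ) (star_one ℂ)])
  map_mul' U V := Subtype.ext (by
    change ((U * V : Matrix.unitaryGroup m ℂ) : Matrix m m ℂ).map star =
      (U : Matrix m m ℂ).map star * (V : Matrix m m ℂ).map star
    ext i j
    simp only [Submonoid.coe_mul, Matrix.map_apply, Matrix.mul_apply, star_sum, star_mul'])

/-- Matrix of `conjU U`: `(Ū)_{ij} = conj U_{ij}`. [folklore] -/
@[simp] theorem coe_conjU (U : Matrix.unitaryGroup m ℂ) :
    ((conjU U : Matrix.unitaryGroup m ℂ) : Matrix m m ℂ) = (U : Matrix m m ℂ).map star := rfl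

/-- `conjU` is continuous. [folklore] -/
theorem continuous_conjU : Continuous (conjU (m := m)) :=
  Continuous.subtype_mk (continuous_subtype_val.matrix_map Complex.continuous_conj) _

/-- **The Kronecker product `(U₁, U₂) ↦ U₁ ⊗ U₂`** as a homomorphism `U(m) × U(n) →* U(m × n)`. [folklore] -/
def kronU : Matrix.unitaryGroup m ℂ × Matrix.unitaryGroup n ℂ →* Matrix.unitaryGroup (m × n) ℂ where
  toFun UV := ⟨(UV.1 : Matrix m m ℂ) ⊗ₖ (UV.2 : Matrix n n ℂ), Matrix.kronecker_mem_unitary UV.1.2 UV.2.2⟩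
  map_one' := Subtype.ext (by
    change ((1 : Matrix.unitaryGroup m ℂ) : Matrix m m ℂ) ⊗ₖ ((1 : Matrix.unitaryGroup n ℂ) : Matrix n n ℂ) = 1
    rw [OneMemClass.coe_one, OneMemClass.coe_one, Matrix.one_kronecker_one])
  map_mul' A B := Subtype.ext (by
    change ((A.1 * B.1 : Matrix.unitaryGroup m ℂ) : Matrix m m ℂ) ⊗ₖ ((A.2 * B.2 : Matrix.unitaryGroup n ℂ) : Matrix n n ℂ) =
      (A.1 : Matrix m m ℂ) ⊗ₖ (A.2 : Matrix n n ℂ) * (B.1 : Matrix m m ℂ) ⊗ₖ (B.2 : Matrix n n ℂ)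
    rw [Submonoid.coe_mul, Submonoid.coe_mul, Matrix.mul_kronecker_mul])

/-- Matrix of `kronU (U₁, U₂)`. [folklore] -/
@[simp] theorem coe_kronU (UV : Matrix.unitaryGroup m ℂ × Matrix.unitaryGroup n ℂ) :
    ((kronU UV : Matrix.unitaryGroup (m × n) ℂ) : Matrix (m × n) (m × n) ℂ) =
      (UV.1 : Matrix m m ℂ) ⊗ₖ (UV.2 : Matrix n n ℂ) := rfl

/-- `kronU` is continuous. [folklore] -/
theorem continuous_kronU : Continuous (kronU (m := m) (n := n)) := by
  refine Continuous.subtype_mk (continuous_matrix fun i j => ?_) _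
  change Continuous fun UV : Matrix.unitaryGroup m ℂ × Matrix.unitaryGroup n ℂ =>
    (UV.1 : Matrix m m ℂ) i.1 j.1 * (UV.2 : Matrix n n ℂ) i.2 j.2
  exact ((continuous_subtype_val.comp continuous_fst).matrix_elem i.1 j.1).mul
    ((continuous_subtype_val.comp continuous_snd).matrix_elem i.2 j.2)

/-- A block-diagonal matrix with unitary blocks is unitary. [folklore] -/
theorem fromBlocks_mem_unitaryGroup {A : Matrix m m ℂ} {D : Matrix n n ℂ} (hA : A ∈ Matrix.unitaryGroup m ℂ)
    (hD : D ∈ Matrix.unitaryGroup n ℂ) : Matrix.fromBlocks A 0 0 D ∈ Matrix.unitaryGroup (m ⊕ n) ℂ := by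
  rw [Matrix.mem_unitaryGroup_iff'] at hA hD ⊢
  rw [star_eq_conjTranspose, Matrix.fromBlocks_conjTranspose, Matrix.fromBlocks_multiply]
  simp only [Matrix.conjTranspose_zero, Matrix.zero_mul, Matrix.mul_zero, add_zero, zero_add]
  rw [← star_eq_conjTranspose, ← star_eq_conjTranspose, hA, hD, Matrix.fromBlocks_one]

/-- **The block sum `(U₁, U₂) ↦ U₁ ⊕ U₂`** as a homomorphism `U(m) × U(n) →* U(m ⊕ n)`. [folklore] -/
def blockU : Matrix.unitaryGroup m ℂ × Matrix.unitaryGroup n ℂ →* Matrix.unitaryGroup (m ⊕ n) ℂ where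
  toFun UV := ⟨Matrix.fromBlocks (UV.1 : Matrix m m ℂ) 0 0 (UV.2 : Matrix n n ℂ),
    fromBlocks_mem_unitaryGroup UV.1.2 UV.2.2⟩
  map_one' := Subtype.ext (by
    change Matrix.fromBlocks ((1 : Matrix.unitaryGroup m ℂ) : Matrix m m ℂ) 0 0
      ((1 : Matrix.unitaryGroup n ℂ) : Matrix n n ℂ) = 1
    rw [OneMemClass.coe_one, OneMemClass.coe_one, Matrix.fromBlocks_one])
  map_mul' A B := Subtype.ext (by
    change Matrix.fromBlocks ((A.1 * B.1 : Matrix.unitaryGroup m ℂ) : Matrix m m ℂ) 0 0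
        ((A.2 * B.2 : Matrix.unitaryGroup n ℂ) : Matrix n n ℂ) =
      Matrix.fromBlocks (A.1 : Matrix m m ℂ) 0 0 (A.2 : Matrix n n ℂ) *
        Matrix.fromBlocks (B.1 : Matrix m m ℂ) 0 0 (B.2 : Matrix n n ℂ)
    rw [Submonoid.coe_mul, Submonoid.coe_mul, Matrix.fromBlocks_multiply]
    simp)

/-- Matrix of `blockU (U₁, U₂)`. [folklore] -/
@[simp] theorem coe_blockU (UV : Matrix.unitaryGroup m ℂ × Matrix.unitaryGroup n ℂ) :
    ((blockU UV : Matrix.unitaryGroup (m ⊕ n) ℂ) : Matrix (m ⊕ n) (m ⊕ n) ℂ) =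
      Matrix.fromBlocks (UV.1 : Matrix m m ℂ) 0 0 (UV.2 : Matrix n n ℂ) := rfl

/-- `blockU` is continuous. [folklore] -/
theorem continuous_blockU : Continuous (blockU (m := m) (n := n)) :=
  Continuous.subtype_mk ((continuous_subtype_val.comp continuous_fst).matrix_fromBlocks continuous_const
    continuous_const (continuous_subtype_val.comp continuous_snd)) _

end Homs

/-! ## 2. The block datum of the compact dual pair -/

section DualPair

variable {P Q R S : Type*} [Fintype P] [DecidableEq P] [Fintype Q] [DecidableEq Q] [Fintype R] [DecidableEq R]
  [Fintype S] [DecidableEq S]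

/-- **Index type of the complex coordinates of `𝕎 = V ⊗ W`**: the two same-sign pair-blocks `V⁺⊗W⁺`, `V⁻⊗W⁻`
first ("holomorphic"), then the two mixed ones `V⁺⊗W⁻`, `V⁻⊗W⁺`. [folklore] -/
abbrev DPIdx (P Q R S : Type*) := ((P × R) ⊕ (Q × S)) ⊕ ((P × S) ⊕ (Q × R))

/-- The compact dual pair group `K × K′ = (U(P) × U(Q)) × (U(R) × U(S))`. [folklore] -/
abbrev DPK (P Q R S : Type*) [Fintype P] [DecidableEq P] [Fintype Q] [DecidableEq Q] [Fintype R] [DecidableEq R]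
    [Fintype S] [DecidableEq S] :=
  (Matrix.unitaryGroup P ℂ × Matrix.unitaryGroup Q ℂ) × (Matrix.unitaryGroup R ℂ × Matrix.unitaryGroup S ℂ)

namespace DPK

/-- The projections `a, b, c, d` of `((a,b),(c,d)) ∈ K × K′`. [folklore] -/
def πa : DPK P Q R S →* Matrix.unitaryGroup P ℂ := (MonoidHom.fst _ _).comp (MonoidHom.fst _ _)
/-- see `πa`. [folklore] -/
def πb : DPK P Q R S →* Matrix.unitaryGroup Q ℂ := (MonoidHom.snd _ _).comp (MonoidHom.fst _ _)
/-- see `πa`. [folklore] -/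
def πc : DPK P Q R S →* Matrix.unitaryGroup R ℂ := (MonoidHom.fst _ _).comp (MonoidHom.snd _ _)
/-- see `πa`. [folklore] -/
def πd : DPK P Q R S →* Matrix.unitaryGroup S ℂ := (MonoidHom.snd _ _).comp (MonoidHom.snd _ _)

end DPK

open DPK in
/-- **The block datum of the compact dual pair** `ι : (U(P)×U(Q)) × (U(R)×U(S)) →* U(DPIdx P Q R S)`,
`((a,b),(c,d)) ↦ diag( conj(a⊗c), conj(b⊗d), a⊗d, b⊗c )` — Kronecker products on the four pair-blocks, the two
same-sign blocks conjugated (Ichino's sign realised in Folland's conventions). [folklore] -/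
def dualPairι : DPK P Q R S →* Matrix.unitaryGroup (DPIdx P Q R S) ℂ :=
  blockU.comp
    ((blockU.comp (((conjU.comp (kronU.comp (πa.prod πc))).prod (conjU.comp (kronU.comp (πb.prod πd)))))).prod
      (blockU.comp ((kronU.comp (πa.prod πd)).prod (kronU.comp (πb.prod πc)))))

/-- The matrix of the block datum. [folklore] -/
theorem coe_dualPairι (k : DPK P Q R S) :
    ((dualPairι k : Matrix.unitaryGroup (DPIdx P Q R S) ℂ) : Matrix (DPIdx P Q R S) (DPIdx P Q R S) ℂ) =
      Matrix.fromBlocks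
        (Matrix.fromBlocks (((k.1.1 : Matrix P P ℂ) ⊗ₖ (k.2.1 : Matrix R R ℂ)).map star) 0 0
          (((k.1.2 : Matrix Q Q ℂ) ⊗ₖ (k.2.2 : Matrix S S ℂ)).map star)) 0 0
        (Matrix.fromBlocks ((k.1.1 : Matrix P P ℂ) ⊗ₖ (k.2.2 : Matrix S S ℂ)) 0 0
          ((k.1.2 : Matrix Q Q ℂ) ⊗ₖ (k.2.1 : Matrix R R ℂ))) := rfl

/-- The block datum is continuous. [folklore] -/
theorem continuous_dualPairι : Continuous (dualPairι (P := P) (Q := Q) (R := R) (S := S)) := by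
  have ha : Continuous (DPK.πa (P := P) (Q := Q) (R := R) (S := S)) := continuous_fst.comp continuous_fst
  have hb : Continuous (DPK.πb (P := P) (Q := Q) (R := R) (S := S)) := continuous_snd.comp continuous_fst
  have hc : Continuous (DPK.πc (P := P) (Q := Q) (R := R) (S := S)) := continuous_fst.comp continuous_snd
  have hd : Continuous (DPK.πd (P := P) (Q := Q) (R := R) (S := S)) := continuous_snd.comp continuous_snd
  exact continuous_blockU.comp
    ((continuous_blockU.comp (((continuous_conjU.comp (continuous_kronU.comp (ha.prodMk hc))).prodMk
      (continuous_conjU.comp (continuous_kronU.comp (hb.prodMk hd)))))).prodMk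
      (continuous_blockU.comp ((continuous_kronU.comp (ha.prodMk hd)).prodMk
        (continuous_kronU.comp (hb.prodMk hc)))))

/-! ## 3. The torus of the dual pair and the polynomial weights -/

omit [DecidableEq P] [DecidableEq Q] [DecidableEq R] [DecidableEq S] in
/-- **The torus character data**: for `(a,b,c,d) = (diag α, diag β, diag γ, diag δ)` the block datum is the
diagonal element of `U(DPIdx)` with entries `(α_p γ_r)⁻¹, (β_q δ_s)⁻¹, α_p δ_s, β_q γ_r` (inverse = conjugate on
`S¹`). [folklore] -/
def dpTorus (α : P → Circle) (β : Q → Circle) (γ : R → Circle) (δ : S → Circle) : DPIdx P Q R S → Circle :=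
  Sum.elim (Sum.elim (fun pr => (α pr.1 * γ pr.2)⁻¹) (fun qs => (β qs.1 * δ qs.2)⁻¹))
    (Sum.elim (fun ps => α ps.1 * δ ps.2) (fun qr => β qr.1 * γ qr.2))

omit [Fintype P] [Fintype Q] [Fintype R] [Fintype S] in
/-- Matrix of the tree's `diagHom`. [folklore] -/
theorem coe_diagHom' {σ : Type*} [Fintype σ] [DecidableEq σ] (t : σ → Circle) :
    ((diagHom t : Matrix.unitaryGroup σ ℂ) : Matrix σ σ ℂ) = Matrix.diagonal fun l => ((t l : Circle) : ℂ) := rfl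

/-- **On the torus the block datum is diagonal**: `ι(diag α, diag β, diag γ, diag δ) = diagHom (dpTorus α β γ δ)`.
[folklore] -/
theorem dualPairι_diagHom (α : P → Circle) (β : Q → Circle) (γ : R → Circle) (δ : S → Circle) :
    dualPairι ((diagHom α, diagHom β), (diagHom γ, diagHom δ)) = diagHom (dpTorus α β γ δ) := by
  apply Subtype.ext
  rw [coe_dualPairι, coe_diagHom']
  simp only [coe_diagHom', Matrix.diagonal_kronecker_diagonal, Matrix.diagonal_map (star_zero ℂ),
    Matrix.fromBlocks_diagonal]
  have key : ∀ z : Circle, star ((z : Circle) : ℂ) = (((z : Circle) : ℂ))⁻¹ := fun z => by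
    rw [Complex.star_def, ← Circle.coe_inv_eq_conj, Circle.coe_inv]
  congr 1
  funext l
  rcases l with ((⟨p, r⟩ | ⟨q, s⟩) | (⟨p, s⟩ | ⟨q, r⟩)) <;>
    simp [dpTorus, star_mul', mul_comm, key]

omit [DecidableEq P] [DecidableEq Q] [DecidableEq R] [DecidableEq S] in
/-- **The polynomial weight of the monomial `z^m` under the dual-pair torus** (tree `torusChar m t = ∏ conj(t_l)^{m_l}`):
positive degree weights on the same-sign blocks, negative (conjugate) on the mixed blocks. [folklore] -/
theorem torusChar_dpTorus (m : DPIdx P Q R S →₀ ℕ) (α : P → Circle) (β : Q → Circle) (γ : R → Circle)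
    (δ : S → Circle) :
    torusChar m (dpTorus α β γ δ) =
      ((∏ pr : P × R, (((α pr.1 * γ pr.2 : Circle)) : ℂ) ^ m (Sum.inl (Sum.inl pr))) *
        ∏ qs : Q × S, (((β qs.1 * δ qs.2 : Circle)) : ℂ) ^ m (Sum.inl (Sum.inr qs))) *
      ((∏ ps : P × S, conj (((α ps.1 * δ ps.2 : Circle)) : ℂ) ^ m (Sum.inr (Sum.inl ps))) *
        ∏ qr : Q × R, conj (((β qr.1 * γ qr.2 : Circle)) : ℂ) ^ m (Sum.inr (Sum.inr qr))) := by
  rw [torusChar, Fintype.prod_sum_type, Fintype.prod_sum_type, Fintype.prod_sum_type]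
  simp only [dpTorus, Sum.elim_inl, Sum.elim_inr, Circle.coe_inv_eq_conj, Complex.conj_conj]

/-- **Weights of a covariant realisation on the dual-pair torus**: for ANY family `ω` of unitaries of
`L²(ℝ^{DPIdx})` Heisenberg-covariant through `dualPairι` (e.g. the archimedean Weil representation of
`(U(p,q), U(r,s))` restricted to `K × K′`, in any realisation) the Hermite function `h_m` is a weight vector of
`k = (diag α, diag β, diag γ, diag δ)` with weight `⟨k_0, ω(k) k_0⟩ · torusChar m (dpTorus α β γ δ)`.
[folklore] -/
theorem IsRhoCovariant.apply_hermiteL2_dualPair_torus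
    {ω : DPK P Q R S → (Lp ℂ 2 (volume : Measure (DPIdx P Q R S → ℝ)) ≃ₗᵢ[ℂ]
      Lp ℂ 2 (volume : Measure (DPIdx P Q R S → ℝ)))}
    (hω : IsRhoCovariant (fun k => dualPairι k) ω) (α : P → Circle) (β : Q → Circle) (γ : R → Circle)
    (δ : S → Circle) (m : DPIdx P Q R S →₀ ℕ) :
    ω ((diagHom α, diagHom β), (diagHom γ, diagHom δ)) (hermiteL2 m) =
      (vacCoeff ω ((diagHom α, diagHom β), (diagHom γ, diagHom δ)) * torusChar m (dpTorus α β γ δ)) •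
        hermiteL2 m :=
  hω.apply_hermiteL2_of_diag (dualPairι_diagHom α β γ δ) m

/-! ## 4. The centre of `U(W)`: degree weights `+1 / −1` -/

omit [DecidableEq P] [DecidableEq Q] [DecidableEq R] [DecidableEq S] in
/-- The block degrees of a multi-index: total degree in the `V⁺⊗W⁺`, `V⁻⊗W⁻`, `V⁺⊗W⁻`, `V⁻⊗W⁺` variables.
[folklore] -/
def degPR (m : DPIdx P Q R S →₀ ℕ) : ℕ := ∑ pr : P × R, m (Sum.inl (Sum.inl pr))
omit [DecidableEq P] [DecidableEq Q] [DecidableEq R] [DecidableEq S] in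
/-- see `degPR`. [folklore] -/
def degQS (m : DPIdx P Q R S →₀ ℕ) : ℕ := ∑ qs : Q × S, m (Sum.inl (Sum.inr qs))
omit [DecidableEq P] [DecidableEq Q] [DecidableEq R] [DecidableEq S] in
/-- see `degPR`. [folklore] -/
def degPS (m : DPIdx P Q R S →₀ ℕ) : ℕ := ∑ ps : P × S, m (Sum.inr (Sum.inl ps))
omit [DecidableEq P] [DecidableEq Q] [DecidableEq R] [DecidableEq S] in
/-- see `degPR`. [folklore] -/
def degQR (m : DPIdx P Q R S →₀ ℕ) : ℕ := ∑ qr : Q × R, m (Sum.inr (Sum.inr qr))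

omit [DecidableEq P] [DecidableEq Q] [DecidableEq R] [DecidableEq S] in
/-- **The `U(W)`-centre weight**: with `a = b = 1` and `c = t·1_R`, `d = t·1_S` (the scalar `t ∈ U(1) = Z(U(W))`)
the polynomial weight of `z^m` is `t^{deg_{PR} m + deg_{QS} m} · t̄^{deg_{PS} m + deg_{QR} m}`: degree `+1` on the
same-sign blocks, `−1` on the mixed blocks ("`z_a ↦ +1`, `w ↦ −1`" of the explicit `(U(1),U(2,1))` model).
[folklore] -/
theorem torusChar_dpTorus_scalarW (m : DPIdx P Q R S →₀ ℕ) (t : Circle) :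
    torusChar m (dpTorus (fun _ : P => (1 : Circle)) (fun _ : Q => (1 : Circle)) (fun _ : R => t) (fun _ : S => t)) =
      ((t : Circle) : ℂ) ^ (degPR m + degQS m) * conj ((t : Circle) : ℂ) ^ (degPS m + degQR m) := by
  rw [torusChar_dpTorus]
  simp only [one_mul, Finset.prod_pow_eq_pow_sum, pow_add, degPR, degQS, degPS, degQR]

omit [DecidableEq P] [DecidableEq Q] [DecidableEq R] [DecidableEq S] in
/-- The same for the centre of `U(V)` (`a = t·1_P`, `b = t·1_Q`, `c = d = 1`): the identical weight — the two
centres act alike, as they must (both are the centre `U(1)` of `U(𝕎)` composed with the block signs). [folklore] -/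
theorem torusChar_dpTorus_scalarV (m : DPIdx P Q R S →₀ ℕ) (t : Circle) :
    torusChar m (dpTorus (fun _ : P => t) (fun _ : Q => t) (fun _ : R => (1 : Circle)) (fun _ : S => (1 : Circle))) =
      ((t : Circle) : ℂ) ^ (degPR m + degQS m) * conj ((t : Circle) : ℂ) ^ (degPS m + degQR m) := by
  rw [torusChar_dpTorus]
  simp only [mul_one, Finset.prod_pow_eq_pow_sum, pow_add, degPR, degQS, degPS, degQR]

end DualPair

end Literature.Analysis.SegalBargmann
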